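import Literature.Computability.MetaComplexity.UniversalHeuristicSchemes
import Literature.Computability.MetaComplexity.UniversalMachineProofs
import Literature.Computability.MetaComplexity.HeuristicClassesProofs
import HarnessLib

/-!
# Universal heuristic schemes (proofs): the machine-independent core of Hirahara's Thm. 6.3 / Cor. 6.4

Sibling proof file of `UniversalHeuristicSchemes.lean`, first instalment towards the discharge of
the named fact `Hirahara2021_mem_DTIME_of_hasUHS` (Hirahara, ECCC TR21-058, Lemma 2.3 = Cor. 6.4:
a universal heuristic scheme for `L` puts `L` in `DTIME(2^{O(n / log n)})`). The printed proof
(Thm. 6.3, p. 31) runs the checker `C(x; 1^{p_i(n)}; 1ᵏ)` along the iterates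
`p_0(n) = n, p_{i+1}(n) = p(p_i(n))` of the scheme's polynomial and answers with the solver at the
first accepting `i ≤ I`; its *correctness* is the telescoping sum
`Σ_{i ≤ I} cd^{p_i(n), p_{i+1}(n)}(x) = K^{p_1(n)}(x) - K^{p_{I+1}(n)}(x) ≤ K^{p(n)}(x) ≤ n + O(1)`,
whence some `i ≤ I` has depth `≤ (n + O(1))/I =: k`. This file proves exactly that, for every
`U : UniversalMachine` (no machine is constructed here; the `2^{O(n / log n)}`-time TM2 machine and
its clock analysis are the remaining instalments):

* `UniversalMachine.exists_ktAt_le_length_add` — the "trivial upper bound" used by Cor. 6.4 in the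
  strong form available in this model: there are constants `c₀, a₀` with `K^t(x) ≤ |x| + a₀` for
  **all** `x` and all budgets `t ≥ c₀` (from `sim` on Mathlib's one-step identity machine, as in
  `UniversalMachine.print_of_sim`);
* `ENat.exists_le_add_succ_of_le` — the telescoping/pigeonhole step in `ℕ∞` without subtraction:
  if `a 1 ≤ B < I (k+1)` then some `1 ≤ i ≤ I` has `a i ≤ k + a (i+1)`;
* `iterate_eval_ge`, `le_iterate_eval_succ` — the iterates `p_i(n)` dominate `n` and `p(n)`
  when `p(m) ≥ m`;
* `exists_checker_accepts_iterate` — **correctness of Thm. 6.3's search**: if `(S, C)` satisfy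
  the two items of Def. 6.2 for a polynomial `p` with `p(m) ≥ max(m, c₀)`, then for every `x` and
  all `I, k` with `|x| + a₀ < I (k+1)` some iterate `t_i = p_i(|x|)`, `1 ≤ i ≤ I`, has
  `C(x; 1^{t_i}; 1ᵏ) = 1`;
* `solver_eq_of_checker_iterate` — and at *any* accepting iterate the solver answers `L(x)`;
* `IsUniversalHeuristicScheme.exists_items_ge` — w.l.o.g. the scheme polynomial dominates any
  given polynomial (enlarging `p` only weakens Def. 6.2, by `cdAt_mono_right`), so the side
  conditions `p(m) ≥ m`, `p(m) ≥ c₀` above are free.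

## References

* S. Hirahara, *Average-case hardness of NP from exponential worst-case hardness assumptions*,
  STOC 2021; full version ECCC TR21-058: Def. 6.1, Def. 6.2, Thm. 6.3 (proof, p. 31), Cor. 6.4.
-/

namespace Literature.Computability.MetaComplexity

open _root_.Computability Complexity

/-! ### A pigeonhole step in `ℕ∞` -/

/-- **Telescoping without subtraction.** For a sequence `a : ℕ → ℕ∞` with `a 1 ≤ B` and natural
numbers `I, k` with `B < I · (k + 1)`, some index `1 ≤ i ≤ I` satisfies `a i ≤ k + a (i + 1)`.
(Otherwise `a i ≥ (k + 1) + a (i + 1)` for all `1 ≤ i ≤ I`, so `a 1 ≥ I (k + 1) + a (I + 1) > B`.)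
This is the form in which the telescoping sum of Hirahara's proof of Thm. 6.3 is used, valid
verbatim for `ℕ∞`-valued `K^t`. [Hirahara 2021 (ECCC TR21-058), proof of Thm. 6.3] [folklore] -/
theorem ENat.exists_le_add_succ_of_le {a : ℕ → ℕ∞} {B I k : ℕ} (h₁ : a 1 ≤ B)
    (hI : B < I * (k + 1)) : ∃ i, 1 ≤ i ∧ i ≤ I ∧ a i ≤ k + a (i + 1) := by
  by_contra hcon
  push Not at hcon
  have key : ∀ j, j ≤ I → ((j * (k + 1) : ℕ) : ℕ∞) + a (j + 1) ≤ a 1 := by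
    intro j
    induction j with
    | zero => intro; simp
    | succ j ih =>
      intro hj
      have hlt := hcon (j + 1) (Nat.succ_pos j) hj
      have hstep : (k : ℕ∞) + 1 + a (j + 1 + 1) ≤ a (j + 1) := by
        have := Order.add_one_le_of_lt hlt
        calc (k : ℕ∞) + 1 + a (j + 1 + 1) = (k : ℕ∞) + a (j + 1 + 1) + 1 := by ring
          _ ≤ a (j + 1) := this
      calc (((j + 1) * (k + 1) : ℕ) : ℕ∞) + a (j + 1 + 1)
          = ((j * (k + 1) : ℕ) : ℕ∞) + ((k : ℕ∞) + 1 + a (j + 1 + 1)) := by push_cast; ring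
        _ ≤ ((j * (k + 1) : ℕ) : ℕ∞) + a (j + 1) := by gcongr
        _ ≤ a 1 := ih (Nat.le_of_succ_le hj)
  have hfin := key I le_rfl
  have h2 : ((I * (k + 1) : ℕ) : ℕ∞) ≤ B :=
    le_trans (le_trans le_self_add hfin) h₁
  exact absurd (Nat.cast_le.mp h2) (not_le.mpr hI)

namespace UniversalMachine

variable (U : UniversalMachine)

/-! ### The trivial upper bound `K^t(x) ≤ |x| + O(1)` -/

/-- **Printing programs at constant budget.** For every universal machine there are constants
`c₀, a₀` such that `K^t(x) ≤ |x| + a₀` for *every* string `x` and every budget `t ≥ c₀`: the code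
`e` and overhead `p` of Mathlib's identity machine (which halts after one step on every input,
`id_outputsWithin_one`) give the program `boolPair e x` of length `|x| + 2|e| + 2` printing `x`
within `p(1)` steps (`exists_ktAt_le_of_outputsWithin`), and `K^t` is antitone in `t`. This is
the bound "`K^{p₀(n)}(x) ≤ n + O(1)` because any string can be described by itself" of the proof
of Cor. 6.4. [Hirahara 2021 (ECCC TR21-058), proof of Cor. 6.4; Liu–Pass 2020, §2.2 (Fact 2.2)]
[cite: Hirahara2021, Cor. 6.4 (proof)] -/
theorem exists_ktAt_le_length_add :
    ∃ c₀ a₀ : ℕ, ∀ (x : List Bool) (t : ℕ), c₀ ≤ t → U.ktAt t x ≤ x.length + a₀ := by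
  obtain ⟨e, p, h⟩ := U.exists_ktAt_le_of_outputsWithin idMachine
  refine ⟨p.eval 1, 2 * e.length + 2, fun x t ht => ?_⟩
  calc U.ktAt t x ≤ U.ktAt (p.eval 1) x := U.ktAt_anti ht x
    _ ≤ x.length + (2 * e.length + 2) := h x x 1 (id_outputsWithin_one x)
    _ = x.length + ((2 * e.length + 2 : ℕ) : ℕ∞) := by push_cast; ring

end UniversalMachine

/-! ### Iterates of the scheme polynomial -/

/-- If `p(m) ≥ m` for all `m` then every iterate satisfies `p_i(n) ≥ n`. [folklore] -/
theorem iterate_eval_ge (p : Polynomial ℕ) (hp : ∀ m, m ≤ p.eval m) (n i : ℕ) :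
    n ≤ (fun m => p.eval m)^[i] n := by
  induction i with
  | zero => exact le_rfl
  | succ i ih =>
    rw [Function.iterate_succ_apply']
    exact ih.trans (hp _)

/-- If `p(m) ≥ m` for all `m` then `p(n) ≤ p_{i+1}(n)` (monotonicity of `ℕ`-polynomials,
`polynomial_eval_mono`, applied to `n ≤ p_i(n)`). [folklore] -/
theorem le_iterate_eval_succ (p : Polynomial ℕ) (hp : ∀ m, m ≤ p.eval m) (n i : ℕ) :
    p.eval n ≤ (fun m => p.eval m)^[i + 1] n := by
  rw [Function.iterate_succ_apply']
  exact polynomial_eval_mono p (iterate_eval_ge p hp n i)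

/-! ### Correctness of the search of Thm. 6.3 -/

section Correctness

variable {U : UniversalMachine} {L : Language Bool} {S C : List Bool → ℕ → ℕ → Bool}
  {p : Polynomial ℕ}

/-- **Some iterate is accepted by the checker.** Let `(S, C)` satisfy item (1) of Def. 6.2 for the
polynomial `p` (for all `x`, `t ≥ p(|x|)`, `k`: `cd^{t,p(t)}(x) ≤ k → C(x; 1ᵗ; 1ᵏ) = 1`), where
`p(m) ≥ m` and `p(m) ≥ c₀` for the constant `c₀` of `exists_ktAt_le_length_add` (both free by
`IsUniversalHeuristicScheme.exists_items_ge`). Then for every `x` (of length `n`) and all `I, k`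
with `n + a₀ < I (k + 1)` there is `1 ≤ i ≤ I` with `C(x; 1^{p_i(n)}; 1ᵏ) = 1`.
Proof: `K^{p_1(n)}(x) ≤ n + a₀`; by `ENat.exists_le_add_succ_of_le` some `i` has
`K^{p_i(n)}(x) ≤ k + K^{p_{i+1}(n)}(x)`, i.e. `cd^{t, p(t)}(x) ≤ k` for `t = p_i(n) ≥ p(n)`
(`cdAt_le_iff`), and item (1) applies. [Hirahara 2021 (ECCC TR21-058), Thm. 6.3 (proof,
correctness claim) and Cor. 6.4] [cite: Hirahara2021, Thm. 6.3 (proof)] -/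
theorem exists_checker_accepts_iterate
    (h₁ : ∀ (x : List Bool) (t k : ℕ), p.eval x.length ≤ t →
      U.cdAt t (p.eval t) x ≤ k → C x t k = true)
    (hp : ∀ m, m ≤ p.eval m) {c₀ a₀ : ℕ}
    (hK : ∀ (x : List Bool) (t : ℕ), c₀ ≤ t → U.ktAt t x ≤ x.length + a₀)
    (hc₀ : ∀ m, c₀ ≤ p.eval m) (x : List Bool) {I k : ℕ} (hIk : x.length + a₀ < I * (k + 1)) :
    ∃ i, 1 ≤ i ∧ i ≤ I ∧ C x ((fun m => p.eval m)^[i] x.length) k = true := by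
  set a : ℕ → ℕ∞ := fun i => U.ktAt ((fun m => p.eval m)^[i] x.length) x with ha
  have h1 : a 1 ≤ (x.length + a₀ : ℕ) := by
    have := hK x (p.eval x.length) (hc₀ _)
    simpa [ha] using this
  obtain ⟨i, hi1, hiI, hi⟩ := ENat.exists_le_add_succ_of_le h1 hIk
  refine ⟨i, hi1, hiI, ?_⟩
  have hdepth : U.cdAt ((fun m => p.eval m)^[i] x.length)
      (p.eval ((fun m => p.eval m)^[i] x.length)) x ≤ k := by
    rw [U.cdAt_le_iff]
    simpa [ha, Function.iterate_succ_apply'] using hi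
  refine h₁ x _ k ?_ hdepth
  obtain ⟨j, rfl⟩ := Nat.exists_eq_add_of_le' hi1
  exact le_iterate_eval_succ p hp x.length j

/-- **At an accepted iterate the solver is correct.** Under item (2) of Def. 6.2 for `p` with
`p(m) ≥ m`, for every `i ≥ 1` with `C(x; 1^{p_i(n)}; 1ᵏ) = 1` the solver returns
`S(x; 1^{p_i(n)}; 1^{2^k}) = L(x)` (the iterate is above the threshold `p(n)`).
[Hirahara 2021 (ECCC TR21-058), Thm. 6.3 (proof)] [cite: Hirahara2021, Thm. 6.3 (proof)] -/
theorem solver_eq_of_checker_iterate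
    (h₂ : ∀ (x : List Bool) (t k : ℕ), p.eval x.length ≤ t →
      C x t k = true → S x t (2 ^ k) = L.boolIndicator x)
    (hp : ∀ m, m ≤ p.eval m) (x : List Bool) {i k : ℕ} (hi : 1 ≤ i)
    (hC : C x ((fun m => p.eval m)^[i] x.length) k = true) :
    S x ((fun m => p.eval m)^[i] x.length) (2 ^ k) = L.boolIndicator x := by
  refine h₂ x _ k ?_ hC
  obtain ⟨j, rfl⟩ := Nat.exists_eq_add_of_le' hi
  exact le_iterate_eval_succ p hp x.length j

end Correctness

/-! ### Enlarging the scheme polynomial -/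

/-- **W.l.o.g. the scheme polynomial is large.** If `(S, C)` is a universal heuristic scheme for
`L`, then for every polynomial `q` the two items of Def. 6.2 hold for some polynomial `p ≥ q`
(pointwise): take `p := p₀ + q` for a witness `p₀`; the threshold only grows, item (2) is
unchanged, and item (1) weakens because `cd^{t,p(t)}(x) ≥ cd^{t,p₀(t)}(x)` (`cdAt_mono_right`,
`p(t) ≥ p₀(t)`). In particular one may assume `p(m) ≥ m` and `p(m) ≥ c₀`.
[Hirahara 2021 (ECCC TR21-058), Def. 6.2 and proof of Thm. 6.3 ("Let `p ≥ p₀` be a sufficiently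
large polynomial that satisfies the definition")] [cite: Hirahara2021, Thm. 6.3 (proof)] -/
theorem UniversalMachine.IsUniversalHeuristicScheme.exists_items_ge {U : UniversalMachine}
    {L : Language Bool} {S C : List Bool → ℕ → ℕ → Bool} (h : U.IsUniversalHeuristicScheme L S C)
    (q : Polynomial ℕ) :
    ∃ p : Polynomial ℕ, (∀ m, q.eval m ≤ p.eval m) ∧
      ∀ (x : List Bool) (t k : ℕ), p.eval x.length ≤ t →
        (U.cdAt t (p.eval t) x ≤ k → C x t k = true) ∧
        (C x t k = true → S x t (2 ^ k) = L.boolIndicator x) := by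
  obtain ⟨p₀, hp₀⟩ := h.exists_polynomial
  refine ⟨p₀ + q, fun m => by simp, fun x t k ht => ?_⟩
  have ht₀ : p₀.eval x.length ≤ t := le_trans (by simp) ht
  obtain ⟨h1, h2⟩ := hp₀ x t k ht₀
  refine ⟨fun hcd => h1 (le_trans (U.cdAt_mono_right t (by simp) x) hcd), h2⟩

end Literature.Computability.MetaComplexity
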